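import Literature.Analysis.SpecialFunctions.BesselK0IntegralBound
import HarnessLib

/-!
# The `K_{1/2}` integral: `∫₀^∞ t^{-3/2} e^{−κ(t + 1/t)} dt = √(π/κ) e^{−2κ}`, and
`∫₀^∞ u^{-3/2} e^{−(β/u + αu)} du = √(π/β) e^{−2√(αβ)}`

Topic `Literature/Analysis/SpecialFunctions`, next to `BesselK0IntegralBound.lean` (whose substitution
`w = (√t − 1/√t)/2` we reuse). Everything here is proved; there are no new definitions.

With `K_ν(z) = ½ ∫₀^∞ e^{−z(u + u⁻¹)/2} u^{ν−1} du` (Bateman–Grosswald 1964, (2)) the classical closed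
form of the Bessel function of half-integral order, `K_{1/2}(z) = K_{−1/2}(z) = (π/2z)^{1/2} e^{−z}`
(Watson, *Treatise*, §3.71 (13)), says, for `z = 2κ`,

  `∫₀^∞ t^{-3/2} e^{−κ(t + 1/t)} dt = ∫₀^∞ t^{-1/2} e^{−κ(t + 1/t)} dt = √(π/κ) e^{−2κ}`.

Proof: the sum of the two integrands is `4 f′(t) e^{−κ(4 f(t)² + 2)}` for the increasing bijection
`f(t) = (√t − 1/√t)/2 : (0, ∞) → ℝ`, so the sum of the two integrals is the Gaussian
`4e^{−2κ} ∫_ℝ e^{−4κw²} dw = 2√(π/κ) e^{−2κ}` (Mathlib's one-dimensional change of variables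
`integral_image_eq_integral_abs_deriv_smul` and `integral_gaussian`); the two integrals are equal by
`t ↦ 1/t` (`integral_comp_rpow_Ioi` with exponent `−1`). Scaling `u = √(β/α) t` gives the second
formula, which is the case `ν = −½` of `∫₀^∞ u^{ν−1} e^{−β/u − αu} du = 2 (β/α)^{ν/2} K_ν(2√(αβ))`.

These are the integrals produced by one theta inversion inside a Mellin transform at `s = 1`
(`Literature/NumberTheory/LFunctions/GaussianThetaValueAtOne.lean`: the value at `s = 1` of the
`L`-series of a weight-one theta series of `ℤ[i]`, after Birch–Swinnerton-Dyer, Crelle 218 (1965), §3).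

## Main statements

* `integral_inv_sqrt_add_eq` — `∫₀^∞ (t^{-1/2} + t^{-3/2}) e^{−κ(t+1/t)} dt = 2√(π/κ) e^{−2κ}`;
* `integral_inv_sqrt_mul_inv_mul_exp_eq` — `∫₀^∞ t^{-3/2} e^{−κ(t+1/t)} dt = √(π/κ) e^{−2κ}`, and
  `integral_inv_sqrt_mul_exp_eq` — the same value for `t^{-1/2}`;
* `integral_inv_sqrt_mul_inv_mul_exp_neg_div_add_mul` —
  `∫₀^∞ u^{-3/2} e^{−(β/u + αu)} du = √(π/β) e^{−2√(αβ)}` (`α, β > 0`), with integrability, and the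
  same in the form `1 / u ^ (3/2)` (`integral_one_div_rpow_mul_exp_neg_div_add_mul`).

## References

* P. T. Bateman, E. Grosswald, *On Epstein's zeta function*, Acta Arith. 9 (1964) 365–373, §2 (2).
* G. N. Watson, *A Treatise on the Theory of Bessel Functions*, 2nd ed. (1944), §3.71 (13), §6.22 (15).
-/

noncomputable section

open MeasureTheory Set Filter Real

namespace Literature.Analysis.SpecialFunctions.BesselKHalf

open BesselK0

/-! ## The substitution `w = (√t − 1/√t)/2` is onto `ℝ` -/

/-- `f(t) = (√t − 1/√t)/2` maps `(0, ∞)` ONTO `ℝ`: `w = f(s²)` for `s = w + √(w² + 1) > 0`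
(`1/s = √(w² + 1) − w`). [folklore] -/
theorem image_sqrt_sub_inv_Ioi :
    (fun t : ℝ => (Real.sqrt t - (Real.sqrt t)⁻¹) / 2) '' Ioi 0 = univ := by
  refine eq_univ_of_forall fun w => ?_
  have hr : |w| < Real.sqrt (w ^ 2 + 1) := by
    rw [← Real.sqrt_sq_eq_abs]
    exact Real.sqrt_lt_sqrt (sq_nonneg w) (by linarith)
  set s : ℝ := w + Real.sqrt (w ^ 2 + 1) with hs
  have hs0 : 0 < s := by
    have := neg_abs_le w
    linarith
  have h2 : Real.sqrt (w ^ 2 + 1) ^ 2 = w ^ 2 + 1 := Real.sq_sqrt (by positivity)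
  have hsinv : s⁻¹ = Real.sqrt (w ^ 2 + 1) - w :=
    inv_eq_of_mul_eq_one_right (by rw [hs]; nlinarith [h2])
  refine ⟨s ^ 2, by simpa using pow_pos hs0 2, ?_⟩
  simp only
  rw [Real.sqrt_sq hs0.le, hsinv]
  ring

/-- The Jacobian identity of the substitution for `K_{±1/2}`: with `f(t) = (√t − 1/√t)/2`,
`f′(t) = (1 + t⁻¹)/(4√t)` and `g(w) = 4e^{−2κ} e^{−4κw²}`,
`|f′(t)| · g(f(t)) = ((√t)⁻¹ + (√t)⁻¹ t⁻¹) e^{−κ(t + 1/t)}` (`t > 0`). [folklore] -/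
theorem jacobian_identity_half (κ : ℝ) {t : ℝ} (ht : 0 < t) :
    |(1 + t⁻¹) / (4 * Real.sqrt t)| *
        (4 * Real.exp (-(2 * κ)) * Real.exp (-(4 * κ) * ((Real.sqrt t - (Real.sqrt t)⁻¹) / 2) ^ 2)) =
      ((Real.sqrt t)⁻¹ + (Real.sqrt t)⁻¹ * t⁻¹) * Real.exp (-κ * (t + t⁻¹)) := by
  have hs : 0 < Real.sqrt t := Real.sqrt_pos.2 ht
  have e1 : Real.exp (-(2 * κ)) * Real.exp (-(4 * κ) * ((Real.sqrt t - (Real.sqrt t)⁻¹) / 2) ^ 2) =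
      Real.exp (-κ * (t + t⁻¹)) := by
    rw [← Real.exp_add, add_inv_eq_four_mul_sq ht]
    ring_nf
  rw [abs_of_pos (by positivity), mul_assoc 4, e1]
  have hs' : Real.sqrt t ≠ 0 := hs.ne'
  have ht' : t ≠ 0 := ht.ne'
  field_simp

/-! ## `∫₀^∞ (t^{-1/2} + t^{-3/2}) e^{−κ(t+1/t)} dt = 2√(π/κ) e^{−2κ}` -/

/-- **Both halves together.** For `κ > 0`, `t ↦ ((√t)⁻¹ + (√t)⁻¹ t⁻¹) e^{−κ(t + 1/t)}` is integrable
on `(0, ∞)` and `∫₀^∞ ((√t)⁻¹ + (√t)⁻¹ t⁻¹) e^{−κ(t + 1/t)} dt = 2√(π/κ) e^{−2κ}`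
(`= 2K_{1/2}(2κ) + 2K_{−1/2}(2κ)` in the normalisation of Bateman–Grosswald (2)).
[cite: Watson1944, §3.71 (13)] -/
theorem integrableOn_and_integral_inv_sqrt_add_eq {κ : ℝ} (hκ : 0 < κ) :
    IntegrableOn (fun t : ℝ => ((Real.sqrt t)⁻¹ + (Real.sqrt t)⁻¹ * t⁻¹) * Real.exp (-κ * (t + t⁻¹)))
        (Ioi 0) ∧
      ∫ t in Ioi (0 : ℝ), ((Real.sqrt t)⁻¹ + (Real.sqrt t)⁻¹ * t⁻¹) * Real.exp (-κ * (t + t⁻¹)) =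
        2 * Real.sqrt (Real.pi / κ) * Real.exp (-(2 * κ)) := by
  set f : ℝ → ℝ := fun t => (Real.sqrt t - (Real.sqrt t)⁻¹) / 2 with hf
  set f' : ℝ → ℝ := fun t => (1 + t⁻¹) / (4 * Real.sqrt t) with hf'
  set g : ℝ → ℝ := fun w => 4 * Real.exp (-(2 * κ)) * Real.exp (-(4 * κ) * w ^ 2) with hg
  have hderiv : ∀ t ∈ Ioi (0 : ℝ), HasDerivWithinAt f (f' t) (Ioi 0) t := fun t ht =>
    (hasDerivAt_sqrt_sub_inv ht).hasDerivWithinAt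
  have hinj : InjOn f (Ioi 0) := strictMonoOn_sqrt_sub_inv.injOn
  have h4 : 0 < 4 * κ := by positivity
  have hgint : Integrable g := (integrable_exp_neg_mul_sq h4).const_mul _
  have hpt : ∀ t ∈ Ioi (0 : ℝ), |f' t| • g (f t) =
      ((Real.sqrt t)⁻¹ + (Real.sqrt t)⁻¹ * t⁻¹) * Real.exp (-κ * (t + t⁻¹)) := fun t ht => by
    simp only [hf, hf', hg, smul_eq_mul]
    exact jacobian_identity_half κ ht
  have himage := integral_image_eq_integral_abs_deriv_smul measurableSet_Ioi hderiv hinj g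
  have hint : IntegrableOn (fun t => |f' t| • g (f t)) (Ioi 0) :=
    (integrableOn_image_iff_integrableOn_abs_deriv_smul measurableSet_Ioi hderiv hinj g).1
      hgint.integrableOn
  refine ⟨hint.congr_fun hpt measurableSet_Ioi, ?_⟩
  rw [← setIntegral_congr_fun measurableSet_Ioi hpt, ← himage]
  have himg : f '' Ioi 0 = univ := image_sqrt_sub_inv_Ioi
  rw [himg, Measure.restrict_univ]
  simp only [hg]
  rw [integral_const_mul, integral_gaussian, sqrt_pi_div_four_mul κ]
  ring

/-! ## The two halves are equal (`t ↦ 1/t`), hence each is `√(π/κ) e^{−2κ}` -/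

/-- For `x > 0`: `x⁻² · √x = (√x)⁻¹ x⁻¹` (the Jacobian algebra of `t ↦ 1/t`). [folklore] -/
theorem rpow_neg_two_mul_sqrt {x : ℝ} (hx : 0 < x) :
    x ^ ((-1 : ℝ) - 1) * (Real.sqrt x⁻¹)⁻¹ = (Real.sqrt x)⁻¹ * x⁻¹ := by
  have hs : 0 < Real.sqrt x := Real.sqrt_pos.2 hx
  rw [Real.sqrt_inv, inv_inv, show ((-1 : ℝ) - 1) = -(2 : ℝ) by norm_num, Real.rpow_neg hx.le,
    Real.rpow_two]
  have hx' : x ≠ 0 := hx.ne'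
  have hs' : Real.sqrt x ≠ 0 := hs.ne'
  field_simp
  rw [← Real.sqrt_mul_self hx.le]
  rw [Real.sqrt_mul_self hx.le]
  nlinarith [Real.mul_self_sqrt hx.le]

/-- **`t ↦ 1/t` exchanges the two halves**:
`∫₀^∞ (√t)⁻¹ t⁻¹ e^{−κ(t+1/t)} dt = ∫₀^∞ (√t)⁻¹ e^{−κ(t+1/t)} dt` (`K_{−1/2} = K_{1/2}`;
Mathlib's `integral_comp_rpow_Ioi` with exponent `−1`). [cite: Watson1944, §3.71 (8)] -/
theorem integral_inv_sqrt_mul_inv_mul_exp_eq_integral_inv_sqrt_mul_exp (κ : ℝ) :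
    ∫ t in Ioi (0 : ℝ), (Real.sqrt t)⁻¹ * t⁻¹ * Real.exp (-κ * (t + t⁻¹)) =
      ∫ t in Ioi (0 : ℝ), (Real.sqrt t)⁻¹ * Real.exp (-κ * (t + t⁻¹)) := by
  have h := integral_comp_rpow_Ioi (fun t : ℝ => (Real.sqrt t)⁻¹ * Real.exp (-κ * (t + t⁻¹)))
    (p := -1) (by norm_num)
  rw [← h]
  refine setIntegral_congr_fun measurableSet_Ioi fun x hx => ?_
  have hx0 : (0 : ℝ) < x := hx
  simp only [smul_eq_mul, abs_neg, abs_one, one_mul, Real.rpow_neg_one]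
  rw [inv_inv, add_comm x⁻¹ x, ← mul_assoc, rpow_neg_two_mul_sqrt hx0]

/-- **`∫₀^∞ t^{-3/2} e^{−κ(t + 1/t)} dt = √(π/κ) e^{−2κ}`** for `κ > 0` (i.e.
`K_{−1/2}(2κ) = √(π/(4κ)) e^{−2κ}`), written with `t^{-3/2} = (√t)⁻¹ t⁻¹`; with integrability.
[cite: Watson1944, §3.71 (13)] -/
theorem integral_inv_sqrt_mul_inv_mul_exp_eq {κ : ℝ} (hκ : 0 < κ) :
    IntegrableOn (fun t : ℝ => (Real.sqrt t)⁻¹ * t⁻¹ * Real.exp (-κ * (t + t⁻¹))) (Ioi 0) ∧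
      ∫ t in Ioi (0 : ℝ), (Real.sqrt t)⁻¹ * t⁻¹ * Real.exp (-κ * (t + t⁻¹)) =
        Real.sqrt (Real.pi / κ) * Real.exp (-(2 * κ)) := by
  obtain ⟨hint, hval⟩ := integrableOn_and_integral_inv_sqrt_add_eq hκ
  have hnnA : ∀ t ∈ Ioi (0 : ℝ), 0 ≤ (Real.sqrt t)⁻¹ * Real.exp (-κ * (t + t⁻¹)) := fun t _ => by
    positivity
  have hnnB : ∀ t ∈ Ioi (0 : ℝ), 0 ≤ (Real.sqrt t)⁻¹ * t⁻¹ * Real.exp (-κ * (t + t⁻¹)) :=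
    fun t ht => by
      have : (0 : ℝ) < t := ht
      positivity
  have hsum : ∀ t : ℝ, ((Real.sqrt t)⁻¹ + (Real.sqrt t)⁻¹ * t⁻¹) * Real.exp (-κ * (t + t⁻¹)) =
      (Real.sqrt t)⁻¹ * Real.exp (-κ * (t + t⁻¹)) +
        (Real.sqrt t)⁻¹ * t⁻¹ * Real.exp (-κ * (t + t⁻¹)) := fun t => by ring
  simp_rw [hsum] at hint hval
  have hcA : ContinuousOn (fun t : ℝ => (Real.sqrt t)⁻¹ * Real.exp (-κ * (t + t⁻¹))) (Ioi 0) := by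
    refine ContinuousOn.mul (ContinuousOn.inv₀ (by fun_prop) fun t ht => ?_) ?_
    · exact (Real.sqrt_pos.2 (show (0:ℝ) < t from ht)).ne'
    · exact ContinuousOn.rexp (continuousOn_const.mul
        (continuousOn_id.add (continuousOn_inv₀.mono fun t ht => ne_of_gt ht)))
  have hcB : ContinuousOn (fun t : ℝ => (Real.sqrt t)⁻¹ * t⁻¹ * Real.exp (-κ * (t + t⁻¹))) (Ioi 0) := by
    refine ContinuousOn.mul (ContinuousOn.mul (ContinuousOn.inv₀ (by fun_prop) fun t ht => ?_)
      (continuousOn_inv₀.mono fun t ht => ne_of_gt ht)) ?_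
    · exact (Real.sqrt_pos.2 (show (0:ℝ) < t from ht)).ne'
    · exact ContinuousOn.rexp (continuousOn_const.mul
        (continuousOn_id.add (continuousOn_inv₀.mono fun t ht => ne_of_gt ht)))
  -- each half is dominated by the (integrable, nonnegative) sum
  have hintA : IntegrableOn (fun t : ℝ => (Real.sqrt t)⁻¹ * Real.exp (-κ * (t + t⁻¹))) (Ioi 0) := by
    refine hint.mono' (hcA.aestronglyMeasurable measurableSet_Ioi) ?_
    filter_upwards [ae_restrict_mem measurableSet_Ioi] with t ht
    rw [Real.norm_eq_abs, abs_of_nonneg (hnnA t ht)]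
    linarith [hnnB t ht]
  have hintB : IntegrableOn (fun t : ℝ => (Real.sqrt t)⁻¹ * t⁻¹ * Real.exp (-κ * (t + t⁻¹)))
      (Ioi 0) := by
    refine hint.mono' (hcB.aestronglyMeasurable measurableSet_Ioi) ?_
    filter_upwards [ae_restrict_mem measurableSet_Ioi] with t ht
    rw [Real.norm_eq_abs, abs_of_nonneg (hnnB t ht)]
    linarith [hnnA t ht]
  refine ⟨hintB, ?_⟩
  rw [integral_add hintA hintB, ← integral_inv_sqrt_mul_inv_mul_exp_eq_integral_inv_sqrt_mul_exp κ]
    at hval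
  linarith

/-- **`∫₀^∞ t^{-1/2} e^{−κ(t + 1/t)} dt = √(π/κ) e^{−2κ}`** for `κ > 0`
(`K_{1/2}(2κ) = √(π/(4κ)) e^{−2κ}`). [cite: Watson1944, §3.71 (13)] -/
theorem integral_inv_sqrt_mul_exp_eq {κ : ℝ} (hκ : 0 < κ) :
    ∫ t in Ioi (0 : ℝ), (Real.sqrt t)⁻¹ * Real.exp (-κ * (t + t⁻¹)) =
      Real.sqrt (Real.pi / κ) * Real.exp (-(2 * κ)) := by
  rw [← integral_inv_sqrt_mul_inv_mul_exp_eq_integral_inv_sqrt_mul_exp κ]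
  exact (integral_inv_sqrt_mul_inv_mul_exp_eq hκ).2

/-! ## Scaling: `∫₀^∞ u^{-3/2} e^{−(β/u + αu)} du = √(π/β) e^{−2√(αβ)}` -/

/-- `(√(β/α))⁻¹ · (√(αβ))⁻¹ = β⁻¹`-type bookkeeping: `√(B/A) √(AB) = B` for `A, B > 0`. [folklore] -/
theorem sqrt_div_mul_sqrt_mul {A B : ℝ} (hA : 0 < A) (hB : 0 < B) :
    Real.sqrt (B / A) * Real.sqrt (A * B) = B := by
  rw [← Real.sqrt_mul (div_pos hB hA).le]
  rw [show B / A * (A * B) = B ^ 2 by field_simp]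
  exact Real.sqrt_sq hB.le

/-- **`∫₀^∞ u^{-3/2} e^{−(β/u + αu)} du = √(π/β) e^{−2√(αβ)}`** for `α, β > 0` (the case
`ν = −½` of `∫₀^∞ u^{ν−1} e^{−β/u−αu} du = 2(β/α)^{ν/2} K_ν(2√(αβ))`, Watson §6.22 (15) with
§3.71 (13)), by the scaling `u = √(β/α) t`; with integrability. Here `u^{-3/2} = (√u)⁻¹ u⁻¹`.
[cite: Watson1944, §6.22 (15) and §3.71 (13)] -/
theorem integral_inv_sqrt_mul_inv_mul_exp_neg_div_add_mul {α β : ℝ} (hα : 0 < α) (hβ : 0 < β) :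
    IntegrableOn (fun u : ℝ => (Real.sqrt u)⁻¹ * u⁻¹ * Real.exp (-(β * u⁻¹ + α * u))) (Ioi 0) ∧
      ∫ u in Ioi (0 : ℝ), (Real.sqrt u)⁻¹ * u⁻¹ * Real.exp (-(β * u⁻¹ + α * u)) =
        Real.sqrt (Real.pi / β) * Real.exp (-(2 * Real.sqrt (α * β))) := by
  obtain ⟨hAl, hBl⟩ := mul_sqrt_div_eq hα hβ
  set κ : ℝ := Real.sqrt (α * β) with hκdef
  have hκ : 0 < κ := Real.sqrt_pos.2 (mul_pos hα hβ)
  set l : ℝ := Real.sqrt (β / α) with hl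
  have hl0 : 0 < l := Real.sqrt_pos.2 (div_pos hβ hα)
  have hsl : 0 < Real.sqrt l := Real.sqrt_pos.2 hl0
  set G : ℝ → ℝ := fun u => (Real.sqrt u)⁻¹ * u⁻¹ * Real.exp (-(β * u⁻¹ + α * u)) with hG
  -- `G(l t) = (√l)⁻¹ l⁻¹ · (√t)⁻¹ t⁻¹ e^{−κ(t + 1/t)}`
  have hcomp : ∀ t : ℝ, G (l * t) =
      (Real.sqrt l)⁻¹ * l⁻¹ * ((Real.sqrt t)⁻¹ * t⁻¹ * Real.exp (-κ * (t + t⁻¹))) := fun t => by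
    simp only [hG]
    rcases le_or_gt t 0 with ht | ht
    · have h1 : Real.sqrt (l * t) = 0 := Real.sqrt_eq_zero'.2 (mul_nonpos_of_nonneg_of_nonpos hl0.le ht)
      have h2 : Real.sqrt t = 0 := Real.sqrt_eq_zero'.2 ht
      simp [h1, h2]
    have e : Real.exp (-(β * (l * t)⁻¹ + α * (l * t))) = Real.exp (-κ * (t + t⁻¹)) := by
      congr 1
      rw [mul_inv, show β * (l⁻¹ * t⁻¹) = (β / l) * t⁻¹ by ring, hBl,
        show α * (l * t) = (α * l) * t by ring, hAl]
      ring
    rw [e, Real.sqrt_mul hl0.le, mul_inv, mul_inv]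
    ring
  have hK := integral_inv_sqrt_mul_inv_mul_exp_eq hκ
  have hint : IntegrableOn G (Ioi 0) := by
    have h1 : IntegrableOn (fun t => G (l * t)) (Ioi 0) := by
      simp_rw [hcomp]
      exact hK.1.const_mul _
    have h2 := (integrableOn_Ioi_comp_mul_left_iff G 0 hl0).1 h1
    rwa [mul_zero] at h2
  refine ⟨hint, ?_⟩
  have h3 := integral_comp_mul_left_Ioi G 0 hl0
  rw [mul_zero] at h3
  simp_rw [hcomp] at h3
  rw [integral_const_mul, smul_eq_mul, hK.2] at h3
  -- solve for `∫ G`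
  have h4 : ∫ x in Ioi (0 : ℝ), G x =
      l * ((Real.sqrt l)⁻¹ * l⁻¹ * (Real.sqrt (Real.pi / κ) * Real.exp (-(2 * κ)))) := by
    rw [h3, ← mul_assoc, mul_inv_cancel₀ hl0.ne', one_mul]
  rw [h4]
  -- `l (√l)⁻¹ l⁻¹ √(π/κ) = √(π/β)`
  have hlk : Real.sqrt l * Real.sqrt κ = Real.sqrt β := by
    rw [← Real.sqrt_mul hl0.le, hl, hκdef, sqrt_div_mul_sqrt_mul hα hβ]
  have hsk : 0 < Real.sqrt κ := Real.sqrt_pos.2 hκ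
  have hsb : 0 < Real.sqrt β := Real.sqrt_pos.2 hβ
  have e1 : l * ((Real.sqrt l)⁻¹ * l⁻¹ * (Real.sqrt (Real.pi / κ) * Real.exp (-(2 * κ)))) =
      (Real.sqrt l)⁻¹ * Real.sqrt (Real.pi / κ) * Real.exp (-(2 * κ)) := by
    field_simp
  rw [e1, Real.sqrt_div' _ hκ.le, Real.sqrt_div' _ hβ.le, ← hlk]
  field_simp

/-- `1 / u ^ (3/2) = (√u)⁻¹ u⁻¹` for `u > 0`. [folklore] -/
theorem one_div_rpow_three_halves {u : ℝ} (hu : 0 < u) :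
    1 / u ^ (3 / 2 : ℝ) = (Real.sqrt u)⁻¹ * u⁻¹ := by
  rw [show (3 / 2 : ℝ) = 1 + 1 / 2 by norm_num, Real.rpow_add hu, Real.rpow_one,
    ← Real.sqrt_eq_rpow, one_div, mul_inv, mul_comm]

/-- The same integral in the form produced by the functional equation of Mathlib's `oddKernel`
(`oddKernel a x = 1 / x ^ (3/2) · sinKernel a (1/x)`): for `α, β > 0`,
`∫₀^∞ (1 / u^{3/2}) e^{−β/u} e^{−αu} du = √(π/β) e^{−2√(αβ)}`, with integrability.
[cite: Watson1944, §6.22 (15) and §3.71 (13)] -/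
theorem integral_one_div_rpow_mul_exp_neg_div_add_mul {α β : ℝ} (hα : 0 < α) (hβ : 0 < β) :
    IntegrableOn (fun u : ℝ => 1 / u ^ (3 / 2 : ℝ) * (Real.exp (-β * (1 / u)) * Real.exp (-α * u)))
        (Ioi 0) ∧
      ∫ u in Ioi (0 : ℝ), 1 / u ^ (3 / 2 : ℝ) * (Real.exp (-β * (1 / u)) * Real.exp (-α * u)) =
        Real.sqrt (Real.pi / β) * Real.exp (-(2 * Real.sqrt (α * β))) := by
  obtain ⟨hint, hval⟩ := integral_inv_sqrt_mul_inv_mul_exp_neg_div_add_mul hα hβ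
  have hpt : ∀ u ∈ Ioi (0 : ℝ), (Real.sqrt u)⁻¹ * u⁻¹ * Real.exp (-(β * u⁻¹ + α * u)) =
      1 / u ^ (3 / 2 : ℝ) * (Real.exp (-β * (1 / u)) * Real.exp (-α * u)) := fun u hu => by
    rw [one_div_rpow_three_halves hu, ← Real.exp_add]
    congr 1
    rw [one_div]
    ring
  exact ⟨hint.congr_fun hpt measurableSet_Ioi,
    by rw [← setIntegral_congr_fun measurableSet_Ioi hpt, hval]⟩

end Literature.Analysis.SpecialFunctions.BesselKHalf

end
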